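import Summits.ValiantsHypothesis.ValiantsHypothesis.Theorems.RigidityForcesSymmetryGrenetFirstOrderRankRigidBlockW0

/-!
# Route RigidityForcesSymmetry — `GrenetFirstOrderRankRigid` (item stmt-ValiantsHypothesis-21029),
line `grenet_gauge`: stub `stub_linearRigid`, step 5 (blocks III / I<, part 1) — evaluating the path
matrix at a column-design point

For the crux line `Cruxes/GrenetFirstOrderRankRigid/Lines/grenet_gauge.lean` (blueprint
`Lines/grenet_gauge-stub_linearRigid-PROOF.md`, §5; interface `Lines/grenet_gauge-stub_linearRigid-BLOCKS.md`).
The block identities (`grenet_tangency_weightSplit`) are read off by EVALUATING them at 0/1 points.  A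
COLUMN DESIGN is a map `d : Fin n → Fin n` (column `c` ↦ row `d c`) together with a set of ACTIVE
columns `act`; its point is `x_{p,c} := [act c ∧ d c = p]` (one cell in every active column, none in
the inactive ones).  This generalises the permutation points of `…BlockW0` (`act = ⊤`, `d` a
permutation).  At such a point a lattice path of Grenet's branching program survives iff it inserts,
at every level `c` it uses, the row `d c` of an ACTIVE column `c`; hence

* `evalDesign_grenet_adj_pow` — `eval ((adj ^ m) S T) = [the levels |S| ≤ c < |S| + m are active with
  d c ∉ S, d is injective there, and S ∪ d(levels) = T]`;
* `evalDesign_grenet_W_empty` — `eval (W ∅ S) = [levels < |S| active, d injective there, d({c < |S|}) = S]`;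
* `evalDesign_grenet_W_univ` — `eval (W T univ) = [levels ≥ |T| active with d c ∉ T, d injective there]`;
* `evalDesign_perPoly_eq_zero` — `eval per_n = 0` as soon as ONE column is inactive (every monomial of
  `per_n` uses every column) — so at a design with a gap the `per`-terms of the tangency identity
  disappear without further bookkeeping.

(`W = adj(1 - adj)` is the lattice-path matrix; statements in the hypothesis form
`hD : D (p, c) = if act c ∧ d c = p then 1 else 0`; the `if`s over the path conditions use classical
decidability.)  No new definitions.  VP ≠ VNP is not moved by this file (first-order bookkeeping about
one matrix family).
-/

noncomputable section

open MvPolynomial Matrix Finset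

namespace Summit.ValiantsHypothesis.Theorems.RigidityForcesSymmetry.GrenetGauge

open Literature.Computability.AlgebraicComplexity

/-! ### Index bookkeeping: levels `s ≤ c < s + m` of `Fin n` versus `Fin m` -/

section Levels

variable {n : ℕ}

/-- The final segment `{|T| ≤ c}` of `Fin n` has `n - |T|` elements. [folklore] -/
theorem card_filter_card_le (T : Finset (Fin n)) :
    (univ.filter fun c : Fin n => T.card ≤ (c : ℕ)).card = n - T.card := by
  have hTn : T.card ≤ n := (Finset.card_le_univ T).trans_eq (Fintype.card_fin n)
  have h := Finset.card_filter_add_card_filter_not (s := (univ : Finset (Fin n)))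
    (fun c : Fin n => (c : ℕ) < T.card)
  rw [Fin.card_filter_val_lt, min_eq_right hTn, Finset.card_univ, Fintype.card_fin] at h
  have h2 : (univ.filter fun c : Fin n => ¬ (c : ℕ) < T.card) = univ.filter fun c : Fin n => T.card ≤ (c : ℕ) :=
    Finset.filter_congr fun c _ => not_lt
  rw [h2] at h
  omega

/-- A property of the shifted levels `s + t`, `t < m`, versus the levels `s ≤ c < s + m`. [folklore] -/
theorem forall_levels_iff (P : Fin n → Prop) {s m : ℕ} (hsm : s + m ≤ n) :
    (∀ t : Fin m, P ⟨s + (t : ℕ), by omega⟩) ↔ ∀ c : Fin n, s ≤ (c : ℕ) → (c : ℕ) < s + m → P c := by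
  constructor
  · intro h c h1 h2
    have hc : (⟨s + (((⟨(c : ℕ) - s, by omega⟩ : Fin m) : ℕ)), by omega⟩ : Fin n) = c :=
      Fin.ext (by simp only; omega)
    rw [← hc]
    exact h _
  · intro h t
    exact h _ (by simp) (by simp)

/-- Injectivity of the shifted sequence `t ↦ d (s + t)` versus injectivity of `d` on the levels
`s ≤ c < s + m`. [folklore] -/
theorem injective_levels_iff (d : Fin n → Fin n) {s m : ℕ} (hsm : s + m ≤ n) :
    Function.Injective (fun t : Fin m => d ⟨s + (t : ℕ), by omega⟩) ↔
      ∀ c c' : Fin n, s ≤ (c : ℕ) → (c : ℕ) < s + m → s ≤ (c' : ℕ) → (c' : ℕ) < s + m →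
        d c = d c' → c = c' := by
  constructor
  · intro h c c' h1 h2 h1' h2' hdd
    have hc : (⟨s + (((⟨(c : ℕ) - s, by omega⟩ : Fin m) : ℕ)), by omega⟩ : Fin n) = c :=
      Fin.ext (by simp only; omega)
    have hc' : (⟨s + (((⟨(c' : ℕ) - s, by omega⟩ : Fin m) : ℕ)), by omega⟩ : Fin n) = c' :=
      Fin.ext (by simp only; omega)
    have key := @h ⟨(c : ℕ) - s, by omega⟩ ⟨(c' : ℕ) - s, by omega⟩ (by simp only; rw [hc, hc']; exact hdd)
    have := Fin.mk.inj_iff.mp key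
    exact Fin.ext (by omega)
  · intro h t t' htt
    have := h ⟨s + (t : ℕ), by omega⟩ ⟨s + (t' : ℕ), by omega⟩ (by simp) (by simp) (by simp) (by simp) htt
    exact Fin.ext (by simpa using Fin.mk.inj_iff.mp this)

/-- The image of the shifted sequence `t ↦ d (s + t)` (`t < m`, `s + m ≤ n`) is `d({s ≤ c < s + m})`.
[folklore] -/
theorem image_levels_eq (d : Fin n → Fin n) {s m : ℕ} (hsm : s + m ≤ n) :
    univ.image (fun t : Fin m => d ⟨s + (t : ℕ), by omega⟩)
      = (univ.filter fun c : Fin n => s ≤ (c : ℕ) ∧ (c : ℕ) < s + m).image d := by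
  ext x
  simp only [Finset.mem_image, Finset.mem_univ, true_and, Finset.mem_filter]
  constructor
  · rintro ⟨t, rfl⟩
    exact ⟨⟨s + (t : ℕ), by omega⟩, ⟨by simp, by simp⟩, rfl⟩
  · rintro ⟨c, ⟨h1, h2⟩, rfl⟩
    exact ⟨⟨(c : ℕ) - s, by omega⟩, by congr 1; ext; simp only; omega⟩

end Levels

/-! ### Evaluation at a column-design point -/

section DesignEval

variable (k : Type*) [CommRing k] {n : ℕ} (D : Fin n × Fin n → k) (d : Fin n → Fin n)
  (act : Fin n → Prop) [DecidablePred act]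
  (hD : ∀ (p c : Fin n), D (p, c) = if act c ∧ d c = p then 1 else 0)

include hD

/-- An arc weight at a column-design point: `wt j c ↦ [act c ∧ d c = j]`. [cite: Grenet2011, Thm. 1] -/
theorem evalDesign_grenet_wt (j : Fin n) {c : ℕ} (hc : c < n) :
    eval D (Grenet.wt k n j c) = if act ⟨c, hc⟩ ∧ d ⟨c, hc⟩ = j then 1 else 0 := by
  rw [eval_grenet_wt, dif_pos hc, hD]

open scoped Classical in
/-- **Powers of the adjacency matrix at a column-design point.**  For `|S| + m ≤ n`,
`eval ((adj ^ m) S T) = 1` if every level `|S| ≤ c < |S| + m` is active with `d c ∉ S`, `d` is injective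
on these levels and `S ∪ d(levels) = T` (the unique surviving path `S → T` inserts `d c` at level `c`);
otherwise `0` (`Fin.card_filter_val_lt` counts the levels). [folklore] -/
theorem evalDesign_grenet_adj_pow {m : ℕ} (S T : Finset (Fin n)) (hsm : S.card + m ≤ n) :
    eval D ((Grenet.adj k n ^ m) S T) =
      if (∀ c : Fin n, S.card ≤ (c : ℕ) → (c : ℕ) < S.card + m → act c ∧ d c ∉ S) ∧
          (∀ c c' : Fin n, S.card ≤ (c : ℕ) → (c : ℕ) < S.card + m → S.card ≤ (c' : ℕ) →
            (c' : ℕ) < S.card + m → d c = d c' → c = c') ∧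
          S ∪ (univ.filter fun c : Fin n => S.card ≤ (c : ℕ) ∧ (c : ℕ) < S.card + m).image d = T
      then 1 else 0 := by
  rw [eval_grenet_adj_pow]
  set g₀ : Fin m → Fin n := fun t => d ⟨S.card + (t : ℕ), by omega⟩ with hg₀
  have hterm : ∀ g : Fin m → Fin n,
      (∏ t : Fin m, eval D (Grenet.wt k n (g t) (S.card + t)))
        = if (∀ t : Fin m, act ⟨S.card + (t : ℕ), by omega⟩) ∧ g = g₀ then 1 else 0 := by
    intro g
    have h1 : ∀ t : Fin m, eval D (Grenet.wt k n (g t) (S.card + t))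
        = if act ⟨S.card + (t : ℕ), by omega⟩ ∧ g₀ t = g t then 1 else 0 := fun t => by
      rw [evalDesign_grenet_wt k D d act hD (g t) (by omega)]
    simp_rw [h1]
    rw [Fintype.prod_boole]
    by_cases hg : (∀ t : Fin m, act ⟨S.card + (t : ℕ), by omega⟩) ∧ g = g₀
    · rw [if_pos hg, if_pos fun t => ⟨hg.1 t, by rw [hg.2]⟩]
    · rw [if_neg hg, if_neg fun h => hg ⟨fun t => (h t).1, funext fun t => ((h t).2).symm⟩]
  simp_rw [hterm]
  rw [Finset.sum_eq_single_of_mem g₀ (Finset.mem_univ _) fun g _ hg => by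
    have hng : ¬ ((∀ t : Fin m, act ⟨S.card + (t : ℕ), by omega⟩) ∧ g = g₀) := fun h => hg h.2
    simp [hng]]
  -- translate the conditions on `g₀ : Fin m → Fin n` into conditions on the levels `c : Fin n`
  have hact := forall_levels_iff (fun c => act c ∧ d c ∉ S) (s := S.card) (m := m) hsm
  have hinj := injective_levels_iff d (s := S.card) (m := m) hsm
  have himg := image_levels_eq d (s := S.card) (m := m) hsm
  by_cases hA : ∀ t : Fin m, act ⟨S.card + (t : ℕ), by omega⟩
  · by_cases hc : Function.Injective g₀ ∧ (∀ t, g₀ t ∉ S) ∧ S ∪ univ.image g₀ = T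
    · rw [if_pos hc, if_pos ⟨hA, rfl⟩,
        if_pos ⟨hact.mp fun t => ⟨hA t, hc.2.1 t⟩, hinj.mp hc.1, himg ▸ hc.2.2⟩]
    · rw [if_neg hc, if_neg]
      rintro ⟨h1, h2, h3⟩
      exact hc ⟨hinj.mpr h2, fun t => ((hact.mpr h1) t).2, himg.symm ▸ h3⟩
  · have hval : (if Function.Injective g₀ ∧ (∀ t, g₀ t ∉ S) ∧ S ∪ univ.image g₀ = T then
        (if (∀ t : Fin m, act ⟨S.card + (t : ℕ), by omega⟩) ∧ g₀ = g₀ then (1 : k) else 0) else 0) = 0 := by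
      split_ifs with h1 h2
      · exact absurd h2.1 hA
      · rfl
      · rfl
    rw [hval, if_neg]
    rintro ⟨h1, -, -⟩
    exact hA fun t => ((hact.mpr h1) t).1

open scoped Classical in
/-- **The source column of the path matrix at a column-design point**:
`eval (W ∅ S) = [all levels c < |S| active, d injective there, d({c < |S|}) = S]`. [folklore] -/
theorem evalDesign_grenet_W_empty (S : Finset (Fin n)) :
    eval D ((1 - Grenet.adj k n).adjugate ∅ S) =
      if (∀ c : Fin n, (c : ℕ) < S.card → act c) ∧
          (∀ c c' : Fin n, (c : ℕ) < S.card → (c' : ℕ) < S.card → d c = d c' → c = c') ∧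
          (univ.filter fun c : Fin n => (c : ℕ) < S.card).image d = S
      then 1 else 0 := by
  have hSn : S.card ≤ n := (Finset.card_le_univ S).trans_eq (Fintype.card_fin n)
  rw [Grenet.adjugate_one_sub (Grenet.wt k n) (grenet_adj_shape k n), Matrix.sum_apply, map_sum]
  -- only the term `m = |S|` survives
  have hm : ∀ m ∈ range (n + 1), eval D ((Grenet.adj k n ^ m) ∅ S)
      = if m = S.card ∧ ((∀ c : Fin n, (c : ℕ) < S.card → act c) ∧
          (∀ c c' : Fin n, (c : ℕ) < S.card → (c' : ℕ) < S.card → d c = d c' → c = c') ∧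
          (univ.filter fun c : Fin n => (c : ℕ) < S.card).image d = S) then 1 else 0 := by
    intro m hm
    have hmn : m ≤ n := Nat.lt_succ_iff.mp (Finset.mem_range.mp hm)
    rw [evalDesign_grenet_adj_pow k D d act hD ∅ S (by rw [Finset.card_empty]; omega)]
    simp only [Finset.card_empty, zero_le, zero_add, true_implies, Finset.notMem_empty,
      not_false_eq_true, and_true, true_and, Finset.empty_union]
    by_cases h : (∀ c : Fin n, (c : ℕ) < m → act c) ∧
        (∀ c c' : Fin n, (c : ℕ) < m → (c' : ℕ) < m → d c = d c' → c = c') ∧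
        (univ.filter fun c : Fin n => (c : ℕ) < m).image d = S
    · have hmS : m = S.card := by
        rw [← h.2.2, Finset.card_image_of_injOn fun c hc c' hc' hcc => h.2.1 c c'
          (Finset.mem_filter.mp (Finset.mem_coe.mp hc)).2 (Finset.mem_filter.mp (Finset.mem_coe.mp hc')).2 hcc,
          Fin.card_filter_val_lt, min_eq_right hmn]
      subst hmS
      rw [if_pos h, if_pos ⟨rfl, h⟩]
    · rw [if_neg h, if_neg]
      rintro ⟨rfl, h'⟩
      exact h h'
  rw [Finset.sum_congr rfl hm, Finset.sum_ite, Finset.sum_const_zero, add_zero, Finset.sum_const,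
    nsmul_eq_mul, mul_one]
  by_cases h : (∀ c : Fin n, (c : ℕ) < S.card → act c) ∧
      (∀ c c' : Fin n, (c : ℕ) < S.card → (c' : ℕ) < S.card → d c = d c' → c = c') ∧
      (univ.filter fun c : Fin n => (c : ℕ) < S.card).image d = S
  · rw [if_pos h]
    have : (range (n + 1)).filter (fun m => m = S.card ∧ ((∀ c : Fin n, (c : ℕ) < S.card → act c) ∧
        (∀ c c' : Fin n, (c : ℕ) < S.card → (c' : ℕ) < S.card → d c = d c' → c = c') ∧
        (univ.filter fun c : Fin n => (c : ℕ) < S.card).image d = S)) = {S.card} := by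
      ext m
      simp only [Finset.mem_filter, Finset.mem_range, Finset.mem_singleton, eq_true h, and_true]
      constructor
      · exact fun h' => h'.2
      · rintro rfl; exact ⟨by omega, rfl⟩
    rw [this, Finset.card_singleton, Nat.cast_one]
  · rw [if_neg h]
    have : (range (n + 1)).filter (fun m => m = S.card ∧ ((∀ c : Fin n, (c : ℕ) < S.card → act c) ∧
        (∀ c c' : Fin n, (c : ℕ) < S.card → (c' : ℕ) < S.card → d c = d c' → c = c') ∧
        (univ.filter fun c : Fin n => (c : ℕ) < S.card).image d = S)) = ∅ :=
      Finset.filter_false_of_mem fun m _ h' => h h'.2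
    rw [this, Finset.card_empty, Nat.cast_zero]

open scoped Classical in
/-- **The sink row of the path matrix at a column-design point**:
`eval (W T univ) = [all levels c ≥ |T| active with d c ∉ T, d injective there]` (the surviving path
`T → univ` inserts the `n - |T|` distinct rows `d c ∉ T`, hence reaches `univ`). [folklore] -/
theorem evalDesign_grenet_W_univ (T : Finset (Fin n)) :
    eval D ((1 - Grenet.adj k n).adjugate T univ) =
      if (∀ c : Fin n, T.card ≤ (c : ℕ) → act c ∧ d c ∉ T) ∧
          (∀ c c' : Fin n, T.card ≤ (c : ℕ) → T.card ≤ (c' : ℕ) → d c = d c' → c = c')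
      then 1 else 0 := by
  have hTn : T.card ≤ n := (Finset.card_le_univ T).trans_eq (Fintype.card_fin n)
  rw [Grenet.adjugate_one_sub (Grenet.wt k n) (grenet_adj_shape k n), Matrix.sum_apply, map_sum,
    Finset.sum_eq_single_of_mem (n - T.card) (Finset.mem_range.mpr (by omega))]
  · rw [evalDesign_grenet_adj_pow k D d act hD T univ (by omega)]
    have hlt : ∀ c : Fin n, (c : ℕ) < T.card + (n - T.card) := fun c => by have := c.isLt; omega
    by_cases h : (∀ c : Fin n, T.card ≤ (c : ℕ) → act c ∧ d c ∉ T) ∧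
        (∀ c c' : Fin n, T.card ≤ (c : ℕ) → T.card ≤ (c' : ℕ) → d c = d c' → c = c')
    · have hfilt : (univ.filter fun c : Fin n => T.card ≤ (c : ℕ) ∧ (c : ℕ) < T.card + (n - T.card))
          = univ.filter fun c : Fin n => T.card ≤ (c : ℕ) :=
        Finset.filter_congr fun c _ => ⟨fun h' => h'.1, fun h' => ⟨h', hlt c⟩⟩
      have hdisj : Disjoint T ((univ.filter fun c : Fin n => T.card ≤ (c : ℕ)).image d) :=
        Finset.disjoint_left.mpr fun x hxT hx => by
          obtain ⟨c, hc, rfl⟩ := Finset.mem_image.mp hx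
          exact (h.1 c (Finset.mem_filter.mp hc).2).2 hxT
      have huniv : T ∪ (univ.filter fun c : Fin n => T.card ≤ (c : ℕ) ∧
          (c : ℕ) < T.card + (n - T.card)).image d = univ := by
        rw [hfilt]
        apply Finset.eq_univ_of_card
        rw [Finset.card_union_of_disjoint hdisj, Finset.card_image_of_injOn fun c hc c' hc' hcc =>
            h.2 c c' (Finset.mem_filter.mp (Finset.mem_coe.mp hc)).2
              (Finset.mem_filter.mp (Finset.mem_coe.mp hc')).2 hcc,
          card_filter_card_le, Fintype.card_fin]
        omega
      rw [if_pos h, if_pos ⟨fun c h1 _ => h.1 c h1, fun c c' h1 _ h1' _ => h.2 c c' h1 h1', huniv⟩]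
    · rw [if_neg h, if_neg]
      rintro ⟨h1, h2, -⟩
      exact h ⟨fun c hc => h1 c hc (hlt c), fun c c' hc hc' => h2 c c' hc (hlt c) hc' (hlt c')⟩
  · intro m _ hne
    rw [eval_grenet_adj_pow]
    refine Finset.sum_eq_zero fun g _ => if_neg ?_
    rintro ⟨hg, hgS, hST⟩
    have h := card_eq_of_pathCondition hg hgS hST
    rw [Finset.card_univ, Fintype.card_fin] at h
    exact hne (by omega)

/-- **The permanent vanishes at a design with an inactive column**: every monomial of `per_n` uses
every column. [folklore] -/
theorem evalDesign_perPoly_eq_zero (c₀ : Fin n) (hc₀ : ¬ act c₀) : eval D (perPoly (Fin n) k) = 0 := by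
  classical
  rw [← grenet_W_empty_univ, evalDesign_grenet_W_empty k D d act hD, if_neg]
  rintro ⟨h, -, -⟩
  exact hc₀ (h c₀ (by rw [Finset.card_univ, Fintype.card_fin]; exact c₀.isLt))

end DesignEval

end Summit.ValiantsHypothesis.Theorems.RigidityForcesSymmetry.GrenetGauge
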